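import Summits.MatrixMultiplication.OmegaCensus.ThreeSetLineCertificate
import HarnessLib

/-!
# Residue certificates for the three-set line identity: the solution modulo `m` and the digit-sum test

ω-census `pub-omega`, family (b3), seat pub-omega-group gen 42.  Framing: lottery ticket; floor = certified bounds/negative
ranges.  VALUE: a kernel TOOL for the three-set cube cells `(4, d, e)@p²` of the Dih-side law census (`ThreeSetZpCells4Core`);
NOT progress on ω, not a proof of LINE LEMMA (β).

Setting (`ThreeSetLineCertificate.lineMat3`): `W F G : ZMod q → ℕ`, hole `s`, constant `K`, and the three-set line identity
`Σ_u M(τ,u)·G(u) + [s = τ] = K` for every `τ`, `M(τ,u) = Σ_v W(v)·(F(τ−u+v) + F(v+u−τ) + F(τ+u−v))`.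
* `lineMat3_cast`: `M(τ,u) = P(τ−u) + Q(τ+u)` with the circulant symbol `P(t) = Σ_v W(v)(F(t+v) + F(v−t))` (`psym`) and
  the Hankel symbol `Q(t) = Σ_v W(v)F(t−v)` (`qsym`), in any commutative ring.
* A MOD-`m` INVERSE CERTIFICATE for the datum `(W, F)` is a pair `α, β : ZMod q → ZMod m` with
  `α ⋆ (P+1) + β ⋆ Q̂ = δ₀` and `α ⋆ Q + β ⋆ (P̂+1) = 0` (`⋆` = cyclic convolution `cconv`, `^` = reflection): then the matrix
  `B(τ₀,τ) = α(τ₀−τ) + β(τ₀+τ)` is a two-sided… (left) inverse of `M + J` modulo `m` (`inverse_apply`; `J` = all-ones).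
* `residue_solution`: summing the identity gives `3·ΣW·ΣF·ΣG + 1 = qK`, so `ΣG = e` is pinned by
  `3·ΣW·ΣF·e + 1 = qK`; then `(M + J)G = (K+e)𝟙 − e_s`, and applying `B`:
  **`G(v) ≡ (K+e)·(Σα + Σβ) − α(v−s) − β(v+s)  (mod m)`** for every `v`.
* `sum_val_le_of_line_identity3`: hence `Σ_v val(that residue) ≤ ΣG = e`; contrapositive
  **`no_line_identity3_of_mod_cert`**: if for EVERY hole `s` the residue digit sum exceeds `e`, the datum `(W, F)` admits no
  solution at all (any `G`, this `K`).
Why this is useful at `m = 4` (census cells `(4,d,e)@p²`, `K = p`): `det(M + J) = ±(3|W||F| + p)·N⁺(D_X)` is odd for every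
`X`-datum, so a mod-4 certificate ALWAYS exists (found by a Frobenius tower in `𝔽₂[C_p]` and one Newton step — untrusted,
only the two convolution identities are checked), and the expected digit sum `≈ 1.5·p` is far above `e`: measured kill rate
100 % on 2·10⁴ random data of the `(4,5,14)@841` / `(4,7,10)@841` killers (two independent engines), genuine solutions pass
exactly at their hole.  The arithmetic is in `ℤ/4`, so the kernel checker runs BIT-SLICED over hundreds of thousands of data at
once (`ThreeSetLineModFourSlice*`).
-/

namespace Summit.MatrixMultiplication.OmegaCensus

open Finset

namespace LineMod

section Symbols

variable {q : ℕ} [NeZero q] {R : Type*} [CommRing R]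

/-- Cyclic convolution of two functions on `ZMod q`: `(f ⋆ g)(t) = Σ_a f(a) g(t − a)`. [folklore] -/
def cconv (f g : ZMod q → R) (t : ZMod q) : R := ∑ a : ZMod q, f a * g (t - a)

/-- The circulant symbol of the three-set line matrix, `P(t) = Σ_v W(v)·(F(t+v) + F(v−t))`, cast into `R`. [folklore] -/
def psym (W F : ZMod q → ℕ) (t : ZMod q) : R := ∑ v : ZMod q, (W v : R) * ((F (t + v) : R) + (F (v - t) : R))

/-- The Hankel symbol of the three-set line matrix, `Q(t) = Σ_v W(v)·F(t−v)`, cast into `R`. [folklore] -/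
def qsym (W F : ZMod q → ℕ) (t : ZMod q) : R := ∑ v : ZMod q, (W v : R) * (F (t - v) : R)

/-- **`M(τ,u) = P(τ−u) + Q(τ+u)`.** [folklore] -/
theorem lineMat3_cast (W F : ZMod q → ℕ) (τ u : ZMod q) :
    (lineMat3 W F τ u : R) = psym W F (τ - u) + qsym W F (τ + u) := by
  unfold lineMat3 psym qsym
  push_cast
  rw [← sum_add_distrib]
  refine sum_congr rfl fun v _ => ?_
  rw [show v + u - τ = v - (τ - u) by abel]
  ring

/-- `Σ_τ α(τ₀ − τ)·X(τ − u) = (α ⋆ X)(τ₀ − u)`. [folklore] -/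
theorem sum_sub_mul_sub (α X : ZMod q → R) (τ₀ u : ZMod q) :
    ∑ τ : ZMod q, α (τ₀ - τ) * X (τ - u) = cconv α X (τ₀ - u) := by
  unfold cconv
  exact Fintype.sum_equiv (Equiv.subLeft τ₀) _ _ fun τ => by
    rw [Equiv.subLeft_apply, show τ₀ - u - (τ₀ - τ) = τ - u by abel]

/-- `Σ_τ α(τ₀ − τ)·X(τ + u) = (α ⋆ X)(τ₀ + u)`. [folklore] -/
theorem sum_sub_mul_add (α X : ZMod q → R) (τ₀ u : ZMod q) :
    ∑ τ : ZMod q, α (τ₀ - τ) * X (τ + u) = cconv α X (τ₀ + u) := by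
  unfold cconv
  exact Fintype.sum_equiv (Equiv.subLeft τ₀) _ _ fun τ => by
    rw [Equiv.subLeft_apply, show τ₀ + u - (τ₀ - τ) = τ + u by abel]

/-- `Σ_τ β(τ₀ + τ)·X(τ − u) = (β ⋆ X̂)(τ₀ + u)`. [folklore] -/
theorem sum_add_mul_sub (β X : ZMod q → R) (τ₀ u : ZMod q) :
    ∑ τ : ZMod q, β (τ₀ + τ) * X (τ - u) = cconv β (fun x => X (-x)) (τ₀ + u) := by
  unfold cconv
  exact Fintype.sum_equiv (Equiv.addLeft τ₀) _ _ fun τ => by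
    simp only [Equiv.coe_addLeft]
    rw [show -(τ₀ + u - (τ₀ + τ)) = τ - u by abel]

/-- `Σ_τ β(τ₀ + τ)·X(τ + u) = (β ⋆ X̂)(τ₀ − u)`. [folklore] -/
theorem sum_add_mul_add (β X : ZMod q → R) (τ₀ u : ZMod q) :
    ∑ τ : ZMod q, β (τ₀ + τ) * X (τ + u) = cconv β (fun x => X (-x)) (τ₀ - u) := by
  unfold cconv
  exact Fintype.sum_equiv (Equiv.addLeft τ₀) _ _ fun τ => by
    simp only [Equiv.coe_addLeft]
    rw [show -(τ₀ - u - (τ₀ + τ)) = τ + u by abel]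

/-- **The inverse certificate.**  If `α ⋆ (P+1) + β ⋆ Q̂ = δ₀` and `α ⋆ Q + β ⋆ (P̂+1) = 0`, then
`B(τ₀,τ) = α(τ₀−τ) + β(τ₀+τ)` satisfies `Σ_τ B(τ₀,τ)·(M(τ,u) + 1) = [τ₀ = u]`. [folklore] -/
theorem inverse_apply {α β : ZMod q → R} {W F : ZMod q → ℕ}
    (h1 : ∀ t, cconv α (fun x => psym W F x + 1) t + cconv β (fun x => qsym W F (-x)) t = if t = 0 then 1 else 0)
    (h2 : ∀ t, cconv α (qsym W F) t + cconv β (fun x => psym W F (-x) + 1) t = 0) (τ₀ u : ZMod q) :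
    ∑ τ : ZMod q, (α (τ₀ - τ) + β (τ₀ + τ)) * ((lineMat3 W F τ u : R) + 1) = if τ₀ = u then 1 else 0 := by
  have e : ∀ τ : ZMod q, (α (τ₀ - τ) + β (τ₀ + τ)) * ((lineMat3 W F τ u : R) + 1) =
      α (τ₀ - τ) * (psym W F (τ - u) + 1) + β (τ₀ + τ) * qsym W F (τ + u) +
        (α (τ₀ - τ) * qsym W F (τ + u) + β (τ₀ + τ) * (psym W F (τ - u) + 1)) := by
    intro τ; rw [lineMat3_cast]; ring
  rw [sum_congr rfl fun τ _ => e τ, sum_add_distrib, sum_add_distrib, sum_add_distrib,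
    sum_sub_mul_sub α (fun x => psym W F x + 1), sum_add_mul_add, sum_sub_mul_add,
    sum_add_mul_sub β (fun x => psym W F x + 1), h1, h2, add_zero]
  simp only [sub_eq_zero]

/-- `Σ_τ B(τ₀,τ) = Σα + Σβ`. [folklore] -/
theorem sum_inverse_row (α β : ZMod q → R) (τ₀ : ZMod q) :
    ∑ τ : ZMod q, (α (τ₀ - τ) + β (τ₀ + τ)) = ∑ t : ZMod q, (α t + β t) := by
  rw [sum_add_distrib, sum_add_distrib]
  congr 1
  · exact Fintype.sum_equiv (Equiv.subLeft τ₀) _ _ fun τ => by rw [Equiv.subLeft_apply]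
  · exact Fintype.sum_equiv (Equiv.addLeft τ₀) _ _ fun τ => by simp only [Equiv.coe_addLeft]

end Symbols

/-! ## The residue solution -/

section Residue

variable {q : ℕ} [NeZero q]

/-- Summing the three-set line identity: `3·ΣW·ΣF·ΣG + 1 = q·K`; with `3·ΣW·ΣF·e + 1 = q·K` this pins `ΣG = e`. [folklore] -/
theorem sum_eq_of_line_identity3 (W F G : ZMod q → ℕ) (s : ZMod q) (K e : ℕ)
    (hid : ∀ τ : ZMod q, (∑ u : ZMod q, lineMat3 W F τ u * G u) + (if s = τ then 1 else 0) = K)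
    (hc : 0 < (∑ v : ZMod q, W v) * ∑ v : ZMod q, F v)
    (he : 3 * ((∑ v : ZMod q, W v) * ∑ v : ZMod q, F v) * e + 1 = q * K) : ∑ v : ZMod q, G v = e := by
  set c := (∑ v : ZMod q, W v) * ∑ v : ZMod q, F v with hcdef
  have htot : 3 * c * (∑ v : ZMod q, G v) + 1 = q * K := by
    have h1 := congrArg (fun f : ZMod q → ℕ => ∑ τ, f τ) (funext hid)
    simp only [sum_add_distrib, sum_const, card_univ, ZMod.card, smul_eq_mul] at h1
    rw [sum_ite_eq, if_pos (mem_univ _), sum_comm] at h1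
    have h2 : ∑ y : ZMod q, ∑ x : ZMod q, lineMat3 W F x y * G y = 3 * c * ∑ v : ZMod q, G v := by
      rw [mul_sum]
      refine sum_congr rfl fun y _ => ?_
      rw [← sum_mul, lineMat3_col_sum, hcdef]
      ring
    omega
  have h3 : 3 * c * (∑ v : ZMod q, G v) = 3 * c * e := by omega
  exact Nat.eq_of_mul_eq_mul_left (by positivity) h3

/-- **The residue solution.**  Under a mod-`m` inverse certificate `(α, β)` for `(W, F)`, every solution `G` with hole `s`
satisfies `ΣG = e` and `G(v) ≡ (K+e)(Σα + Σβ) − α(v−s) − β(v+s) (mod m)`. [folklore] -/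
theorem residue_solution {m : ℕ} (W F G : ZMod q → ℕ) (s : ZMod q) (K e : ℕ)
    (hid : ∀ τ : ZMod q, (∑ u : ZMod q, lineMat3 W F τ u * G u) + (if s = τ then 1 else 0) = K)
    (hc : 0 < (∑ v : ZMod q, W v) * ∑ v : ZMod q, F v)
    (he : 3 * ((∑ v : ZMod q, W v) * ∑ v : ZMod q, F v) * e + 1 = q * K)
    (α β : ZMod q → ZMod m)
    (h1 : ∀ t, cconv α (fun x => psym W F x + 1) t + cconv β (fun x => qsym W F (-x)) t = if t = 0 then 1 else 0)
    (h2 : ∀ t, cconv α (qsym W F) t + cconv β (fun x => psym W F (-x) + 1) t = 0) :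
    (∑ v : ZMod q, G v = e) ∧ ∀ v : ZMod q,
      (G v : ZMod m) = ((K + e : ℕ) : ZMod m) * (∑ t : ZMod q, (α t + β t)) - α (v - s) - β (v + s) := by
  have hsum := sum_eq_of_line_identity3 W F G s K e hid hc he
  refine ⟨hsum, fun v => ?_⟩
  -- the rows of `(M + J) G = (K + e)𝟙 − e_s` in `ZMod m`
  have hrow : ∀ τ : ZMod q, ∑ u : ZMod q, ((lineMat3 W F τ u : ZMod m) + 1) * (G u : ZMod m) =
      ((K + e : ℕ) : ZMod m) - (if s = τ then 1 else 0) := by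
    intro τ
    have h := congrArg (Nat.cast : ℕ → ZMod m) (hid τ)
    push_cast at h
    have hG : ∑ u : ZMod q, (G u : ZMod m) = (e : ZMod m) := by rw [← Nat.cast_sum, hsum]
    simp_rw [add_mul, one_mul]
    rw [sum_add_distrib, hG]
    push_cast
    rw [← h]
    ring
  -- apply `B`
  have key : ∑ τ : ZMod q, (α (v - τ) + β (v + τ)) * ∑ u : ZMod q, ((lineMat3 W F τ u : ZMod m) + 1) * (G u : ZMod m) =
      (G v : ZMod m) := by
    have hswap : ∑ τ : ZMod q, (α (v - τ) + β (v + τ)) * ∑ u : ZMod q, ((lineMat3 W F τ u : ZMod m) + 1) * (G u : ZMod m) =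
        ∑ u : ZMod q, (∑ τ : ZMod q, (α (v - τ) + β (v + τ)) * ((lineMat3 W F τ u : ZMod m) + 1)) * (G u : ZMod m) := by
      simp_rw [mul_sum, sum_mul]
      rw [sum_comm]
      exact sum_congr rfl fun u _ => sum_congr rfl fun τ _ => by ring
    rw [hswap, sum_congr rfl fun u _ => by rw [inverse_apply h1 h2 v u]]
    simp only [ite_mul, one_mul, zero_mul, sum_ite_eq, mem_univ, if_true]
  rw [← key, sum_congr rfl fun τ _ => by rw [hrow τ]]
  simp_rw [mul_sub, mul_ite, mul_one, mul_zero]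
  rw [sum_sub_distrib, ← sum_mul, sum_inverse_row, sum_ite_eq, if_pos (mem_univ _)]
  ring

/-- **The digit-sum bound.**  Under a mod-`m` inverse certificate, the sum of the residues
`val((K+e)(Σα+Σβ) − α(v−s) − β(v+s))` over `v` is at most `e` for the hole `s` of any solution. [folklore] -/
theorem sum_val_le_of_line_identity3 {m : ℕ} [NeZero m] (W F G : ZMod q → ℕ) (s : ZMod q) (K e : ℕ)
    (hid : ∀ τ : ZMod q, (∑ u : ZMod q, lineMat3 W F τ u * G u) + (if s = τ then 1 else 0) = K)
    (hc : 0 < (∑ v : ZMod q, W v) * ∑ v : ZMod q, F v)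
    (he : 3 * ((∑ v : ZMod q, W v) * ∑ v : ZMod q, F v) * e + 1 = q * K)
    (α β : ZMod q → ZMod m)
    (h1 : ∀ t, cconv α (fun x => psym W F x + 1) t + cconv β (fun x => qsym W F (-x)) t = if t = 0 then 1 else 0)
    (h2 : ∀ t, cconv α (qsym W F) t + cconv β (fun x => psym W F (-x) + 1) t = 0) :
    ∑ v : ZMod q, (((K + e : ℕ) : ZMod m) * (∑ t : ZMod q, (α t + β t)) - α (v - s) - β (v + s)).val ≤ e := by
  obtain ⟨hsum, hres⟩ := residue_solution W F G s K e hid hc he α β h1 h2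
  calc ∑ v : ZMod q, (((K + e : ℕ) : ZMod m) * (∑ t : ZMod q, (α t + β t)) - α (v - s) - β (v + s)).val
      = ∑ v : ZMod q, ((G v : ℕ) : ZMod m).val := sum_congr rfl fun v _ => by rw [hres v]
    _ ≤ ∑ v : ZMod q, G v := sum_le_sum fun v _ => by rw [ZMod.val_natCast]; exact Nat.mod_le _ _
    _ = e := hsum

/-- **No solution when every hole fails the digit-sum test.**  If `(α, β)` is a mod-`m` inverse certificate for `(W, F)`
and for every hole `s` the residue digit sum exceeds `e` (where `3·ΣW·ΣF·e + 1 = qK`), the three-set line identity with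
constant `K` has no solution `G` at all. [folklore] -/
theorem no_line_identity3_of_mod_cert {m : ℕ} [NeZero m] (W F : ZMod q → ℕ) (K e : ℕ)
    (hc : 0 < (∑ v : ZMod q, W v) * ∑ v : ZMod q, F v)
    (he : 3 * ((∑ v : ZMod q, W v) * ∑ v : ZMod q, F v) * e + 1 = q * K)
    (α β : ZMod q → ZMod m)
    (h1 : ∀ t, cconv α (fun x => psym W F x + 1) t + cconv β (fun x => qsym W F (-x)) t = if t = 0 then 1 else 0)
    (h2 : ∀ t, cconv α (qsym W F) t + cconv β (fun x => psym W F (-x) + 1) t = 0)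
    (hfail : ∀ s : ZMod q,
      e < ∑ v : ZMod q, (((K + e : ℕ) : ZMod m) * (∑ t : ZMod q, (α t + β t)) - α (v - s) - β (v + s)).val)
    (G : ZMod q → ℕ) (s : ZMod q) :
    ¬ ∀ τ : ZMod q, (∑ u : ZMod q, lineMat3 W F τ u * G u) + (if s = τ then 1 else 0) = K := fun hid =>
  absurd (sum_val_le_of_line_identity3 W F G s K e hid hc he α β h1 h2) (not_le.2 (hfail s))

end Residue

end LineMod

end Summit.MatrixMultiplication.OmegaCensus
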